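import Mathlib.NumberTheory.Height.NumberField
import Mathlib.NumberTheory.NumberField.Basic
import Mathlib.Analysis.SpecialFunctions.Pow.Real
import Mathlib.Analysis.Complex.Basic
import Mathlib.RingTheory.MvPolynomial.Basic

/-!
# Shape constraints on the lever `OrbitClusterBound` of line `orbit-interpolation-determinant`
(crux `ApproximationProperty`, stmt-Schanuel-6117; negative lemmas, route DiophantineDichotomy)

The lever of the picked line (skeleton `Cruxes/ApproximationProperty/Lines/orbit-interpolation-determinant.lean`,
lead's reshape of 2026-08-16, stub `stub_orbitClusterBound`) is
`OrbitClusterBound : ∀ t, 1 ≤ t → ∃ c₀ > 0, ∃ C > 0, Φ t c₀ C`, where `Φ t c₀ C` says: for every number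
field `K`, `β ∈ Kᵗ` whose monomials of degree `≤ δ` span `K`, `k` DISTINCT complex embeddings `σᵢ` with
`‖σᵢ β − x‖ ≤ r ≤ 1`, one has
`(c₀ k^{1+1/t} − k) log(1/r) ≤ C (δ h_K(1:β) + D log(D+1) + k δ log(2+‖x‖) + k log(δ+2))`, `D = [K:ℚ]`.
Two kernel-checked facts about its SHAPE (the body `Φ` is inlined verbatim below; the Lines file is not
importable):

* `c₀_le_one_of_orbitClusterBoundWith` — in every dimension `t ≥ 1`, ANY admissible constant has `c₀ ≤ 1`:
  with one embedding (`k = 1`), `x = σβ` itself and `r = e^{−M} → 0⁺` the left side is `(c₀ − 1) M`, the right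
  side is constant (witness `K = ℚ`, `β = 0`, `δ = 0`: `(c₀ − 1) M ≤ 2 C log 2`). So the vacuity window
  `k ≤ c₀^{−t}` of the lever is forced, not a convenience: clusters of bounded size cost nothing.
* `orbitClusterBound_false_without_injective` — the hypothesis `Function.Injective σ` is load-bearing:
  dropping it, one embedding of `ℚ` counted `k = ⌈2/c₀⌉₊` times (`β = 0 = x`, `δ = 0`, `r = e^{−M}`) gives a
  left side `k (c₀ k − 1) M ≥ M` against the right side `C (k + 1) log 2`; false at `t = 1` already.

Everything is proved; no definitions, no named facts.
-/

noncomputable section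

-- `Summit.Schanuel.Schanuel.…` is the mandated summit/sub-problem namespace (single-conjunct summit):
set_option linter.dupNamespace false

namespace Summit.Schanuel.Schanuel.Theorems.ApproximationPropertyOrbitClusterBoundShape

/-- In `K = ℚ` the constants span everything in degree `≤ δ` (at `β = 0`). [folklore] -/
theorem span_rat (t δ : ℕ) (z : ℚ) :
    ∃ Q : MvPolynomial (Fin t) ℚ, Q.totalDegree ≤ δ ∧ MvPolynomial.aeval (0 : Fin t → ℚ) Q = z :=
  ⟨MvPolynomial.C z, by simp, by simp⟩

/-- The cluster hypothesis at `K = ℚ`, `β = 0`, `x = 0`: every "conjugate" sits at the centre. [folklore] -/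
theorem cluster_rat (t k : ℕ) (σ : Fin k → (ℚ →+* ℂ)) {r : ℝ} (hr : 0 ≤ r) (i : Fin k) :
    ‖(fun j : Fin t => σ i ((0 : Fin t → ℚ) j)) - 0‖ ≤ r := by
  have h0 : (fun j : Fin t => σ i ((0 : Fin t → ℚ) j)) - 0 = 0 := by
    ext j; simp
  rw [h0, norm_zero]
  exact hr

/-- `log (1 / e^{−M}) = M`. [folklore] -/
theorem log_one_div_exp_neg (M : ℝ) : Real.log (1 / Real.exp (-M)) = M := by
  rw [Real.exp_neg, one_div, inv_inv, Real.log_exp]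

/-- **Any admissible `c₀` in `OrbitClusterBound` is `≤ 1`** (every `t`; the lever has `t ≥ 1`). The hypothesis `h` is the body
of the lever at exponent `t` with constants `c₀, C`, verbatim; the instance `K = ℚ`, `β = 0`, `δ = 0`,
`k = 1`, `x = 0`, `r = e^{−M}` reads `(c₀ − 1) M ≤ 2 C log 2` for every `M ≥ 0`. [folklore] -/
theorem c₀_le_one_of_orbitClusterBoundWith {t : ℕ} {c₀ C : ℝ}
    (h : ∀ (K : Type) [Field K] [NumberField K] (β : Fin t → K) (δ k : ℕ) (σ : Fin k → (K →+* ℂ))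
      (x : Fin t → ℂ) (r : ℝ),
      (∀ z : K, ∃ Q : MvPolynomial (Fin t) ℚ, Q.totalDegree ≤ δ ∧ MvPolynomial.aeval β Q = z) →
      Function.Injective σ → 0 < r → r ≤ 1 →
      (∀ i, ‖(fun j => σ i (β j)) - x‖ ≤ r) →
      (c₀ * (k : ℝ) ^ (1 + 1 / (t : ℝ)) - k) * Real.log (1 / r) ≤
        C * (δ * Height.logHeight (Fin.cons (1 : K) β : Fin (t + 1) → K) +
          Module.finrank ℚ K * Real.log (Module.finrank ℚ K + 1) +
          k * δ * Real.log (2 + ‖x‖) + k * Real.log ((δ : ℝ) + 2))) :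
    c₀ ≤ 1 := by
  by_contra hc
  have hc1 : 0 < c₀ - 1 := by linarith [not_le.mp hc]
  -- the scale `r = e^{-M}`
  set M : ℝ := (2 * |C| * Real.log 2 + 1) / (c₀ - 1) + 1 with hM
  have hM0 : 0 ≤ M := by
    have : 0 ≤ (2 * |C| * Real.log 2 + 1) / (c₀ - 1) := div_nonneg (by positivity) hc1.le
    linarith
  have hr0 : 0 < Real.exp (-M) := Real.exp_pos _
  have hr1 : Real.exp (-M) ≤ 1 := by
    rw [Real.exp_le_one_iff]; linarith
  have key := h ℚ (0 : Fin t → ℚ) 0 1 (fun _ => Rat.castHom ℂ) 0 (Real.exp (-M))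
    (span_rat t 0) (Function.injective_of_subsingleton _) hr0 hr1 (cluster_rat t 1 _ hr0.le)
  rw [log_one_div_exp_neg] at key
  simp only [Nat.cast_one, Real.one_rpow, Nat.cast_zero, zero_mul, zero_add, mul_zero, add_zero,
    Module.finrank_self, one_mul] at key
  -- key : (c₀ - 1) * M ≤ C * (Real.log (1 + 1) + Real.log 2)
  have hlog : Real.log (1 + 1) + Real.log 2 = 2 * Real.log 2 := by norm_num [two_mul]
  rw [hlog] at key
  have h2 : 0 ≤ Real.log 2 := Real.log_nonneg (by norm_num)
  have hC : C * (2 * Real.log 2) ≤ 2 * |C| * Real.log 2 := by nlinarith [le_abs_self C, h2]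
  have hprod : (c₀ - 1) * M = 2 * |C| * Real.log 2 + 1 + (c₀ - 1) := by
    rw [hM, mul_add, mul_one, mul_div_cancel₀ _ hc1.ne']
  linarith

/-- **`Function.Injective σ` is load-bearing in `OrbitClusterBound`.** The lever with the injectivity
hypothesis dropped (everything else verbatim) is FALSE, already at `t = 1`: one embedding of `ℚ` counted
`k = ⌈2/c₀⌉₊` times, `β = 0 = x`, `δ = 0`, `r = e^{−M}` with `M = C (k+1) log 2 + 1`. [folklore] -/
theorem orbitClusterBound_false_without_injective :
    ¬ (∀ t : ℕ, 1 ≤ t → ∃ c₀ : ℝ, 0 < c₀ ∧ ∃ C : ℝ, 0 < C ∧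
      ∀ (K : Type) [Field K] [NumberField K] (β : Fin t → K) (δ k : ℕ) (σ : Fin k → (K →+* ℂ))
        (x : Fin t → ℂ) (r : ℝ),
        (∀ z : K, ∃ Q : MvPolynomial (Fin t) ℚ, Q.totalDegree ≤ δ ∧ MvPolynomial.aeval β Q = z) →
        0 < r → r ≤ 1 →
        (∀ i, ‖(fun j => σ i (β j)) - x‖ ≤ r) →
        (c₀ * (k : ℝ) ^ (1 + 1 / (t : ℝ)) - k) * Real.log (1 / r) ≤
          C * (δ * Height.logHeight (Fin.cons (1 : K) β : Fin (t + 1) → K) +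
            Module.finrank ℚ K * Real.log (Module.finrank ℚ K + 1) +
            k * δ * Real.log (2 + ‖x‖) + k * Real.log ((δ : ℝ) + 2))) := by
  intro h
  obtain ⟨c₀, hc₀, C, hC, hall⟩ := h 1 le_rfl
  -- the multiplicity `k = ⌈2/c₀⌉₊`
  set k : ℕ := ⌈2 / c₀⌉₊ with hk
  have hk2 : 2 / c₀ ≤ (k : ℝ) := Nat.le_ceil _
  have hkc : 2 ≤ c₀ * k := by
    have := mul_le_mul_of_nonneg_left hk2 hc₀.le
    rwa [mul_div_cancel₀ _ hc₀.ne'] at this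
  have hk0 : (0 : ℝ) ≤ k := Nat.cast_nonneg _
  -- the scale `r = e^{-M}`
  set M : ℝ := C * ((k : ℝ) + 1) * Real.log 2 + 1 with hM
  have hlog2 : 0 ≤ Real.log 2 := Real.log_nonneg (by norm_num)
  have hM0 : 0 ≤ M := by
    have : 0 ≤ C * ((k : ℝ) + 1) * Real.log 2 := by positivity
    linarith
  have hr0 : 0 < Real.exp (-M) := Real.exp_pos _
  have hr1 : Real.exp (-M) ≤ 1 := by
    rw [Real.exp_le_one_iff]; linarith
  have key := hall ℚ (0 : Fin 1 → ℚ) 0 k (fun _ => Rat.castHom ℂ) 0 (Real.exp (-M))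
    (span_rat 1 0) hr0 hr1 (cluster_rat 1 k _ hr0.le)
  rw [log_one_div_exp_neg] at key
  have hpow : ((k : ℕ) : ℝ) ^ (1 + 1 / ((1 : ℕ) : ℝ)) = (k : ℝ) * k := by
    rw [Nat.cast_one, div_one, show (1 : ℝ) + 1 = (2 : ℕ) by norm_num, Real.rpow_natCast, pow_two]
  rw [hpow] at key
  simp only [Nat.cast_zero, zero_mul, zero_add, mul_zero, add_zero, Module.finrank_self,
    Nat.cast_one, one_mul] at key
  -- key : (c₀ * (k * k) - k) * M ≤ C * (Real.log (1 + 1) + k * Real.log 2)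
  have hrhs : C * (Real.log (1 + 1) + k * Real.log 2) = C * ((k : ℝ) + 1) * Real.log 2 := by
    norm_num; ring
  rw [hrhs] at key
  have hcoef : (1 : ℝ) ≤ c₀ * (k * k) - k := by
    have e : c₀ * (k * k) - k = k * (c₀ * k - 1) := by ring
    rw [e]
    have hk1 : (1 : ℝ) ≤ k := by
      have : (2 : ℝ) ≤ c₀ * k := hkc
      by_contra hlt
      have hlt' : (k : ℝ) < 1 := not_le.mp hlt
      have hk00 : k = 0 := by
        have : k < 1 := by exact_mod_cast hlt'
        omega
      have : (k : ℝ) = 0 := by exact_mod_cast hk00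
      rw [this, mul_zero] at hkc
      linarith
    nlinarith
  have hLHS : M ≤ (c₀ * (k * k) - k) * M := by nlinarith
  linarith

end Summit.Schanuel.Schanuel.Theorems.ApproximationPropertyOrbitClusterBoundShape

end
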